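import Summits.CriticalPhenomena.PercolationContinuityZ3.Theorems.PercNearOneGluingNoHeavyPcintMemUniformChunk
import HarnessLib

/-!
# CriticalPhenomena/PercolationContinuityZ3 — Theorems/PercNearOneGluingNoHeavyPcintMemUniformChunkFast.lean: a closure-free tuple model of `mstep` on `ℤ⁶` and the FAST structural row check of chunked row lists, with soundness

Lane prim-pcint, STRUCTURE rule (prim-pcint-2 GEN 19).  Deciding `mstep 10 S a = some (g • S')` on `Finset`s of functions
`Fin 6 → ℤ` costs ≈ 2.7 s of kernel time per row of the 6192-row memory-10 list (3.7 h in all); this file replaces it by integer-tuple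
arithmetic (≈ 0.2 s per row) and PROVES the replacement sound:

* `T6 = ℤ⁶` as nested pairs, `tsite`, `stepT`, `subT`, `negT`, `l1T`, **`mstepT`** with `mstep τ (ofListState S) a =
  (mstepT τ S a).map ofListState` (`mstep_ofListState`);
* signed permutations by NUMBER: Lehmer decoding `fpermVal` of the lexicographic index, `fsmul c`, and `tsite (fsmul c t) =
  smulSite (spermOf6 P c) (tsite t)` given the decidable consistency `PermsOK P` of the table of transposition products;
* **`URowOKF` / `URowsOKF`** (`Bool`, row ranges) and **`urowOKC_of_fast` / `urowsOKC_of_fast`**: a passing fast check gives the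
  structural row condition `URowOKC` of …PcintMemUniformChunk (hence `UStructK` by `ustructK_of_chunks`); `USuppRowsF` likewise.

HONEST FRAMING: kernel-cost engineering with a soundness proof; no mathematics.  No `sorry`; standard axioms.
Written by prim-pcint-2 gen 19 (prover-prim-pcint-2-g19-0), 2026-08-26.
-/

namespace Summit.CriticalPhenomena.PercolationContinuityZ3.Theorems.Pcint

open Literature.Probability.Percolation Literature.Probability.LatticeModels

/-! ### A fast, closure-free model of `mstep` on tuple lists, and the fast structural row check -/

section Fast

/-- `tsite` is injective. [folklore] -/
theorem tsite_injective : Function.Injective tsite := by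
  rintro ⟨a0, a1, a2, a3, a4, a5⟩ ⟨b0, b1, b2, b3, b4, b5⟩ h
  have h0 := congrFun h 0; have h1 := congrFun h 1; have h2 := congrFun h 2
  have h3 := congrFun h 3; have h4 := congrFun h 4; have h5 := congrFun h 5
  simp [tsite] at h0 h1 h2 h3 h4 h5
  simp [h0, h1, h2, h3, h4, h5]

/-- `tget` at a `Fin 6` value is `tsite`. [folklore] -/
theorem tget_fin (t : T6) (j : Fin 6) : tget t j = tsite t j := by
  fin_cases j <;> rfl

/-- The step tuple of a letter. [folklore] -/
def stepT (a : Fin 6 × Bool) : T6 :=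
  (if (a.1 : ℕ) = 0 then (if a.2 then 1 else -1) else 0, if (a.1 : ℕ) = 1 then (if a.2 then 1 else -1) else 0,
    if (a.1 : ℕ) = 2 then (if a.2 then 1 else -1) else 0, if (a.1 : ℕ) = 3 then (if a.2 then 1 else -1) else 0,
    if (a.1 : ℕ) = 4 then (if a.2 then 1 else -1) else 0, if (a.1 : ℕ) = 5 then (if a.2 then 1 else -1) else 0)

/-- `tsite (stepT a) = stepVec a`. [folklore] -/
theorem tsite_stepT (a : Fin 6 × Bool) : tsite (stepT a) = stepVec a := by
  revert a; decide

/-- Componentwise difference. [folklore] -/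
def subT (s t : T6) : T6 := (s.1 - t.1, s.2.1 - t.2.1, s.2.2.1 - t.2.2.1, s.2.2.2.1 - t.2.2.2.1, s.2.2.2.2.1 - t.2.2.2.2.1,
  s.2.2.2.2.2 - t.2.2.2.2.2)

/-- `tsite` of a difference. [folklore] -/
theorem tsite_subT (s t : T6) : tsite (subT s t) = tsite s - tsite t := by
  ext i; fin_cases i <;> rfl

/-- Componentwise negation. [folklore] -/
def negT (t : T6) : T6 := (-t.1, -t.2.1, -t.2.2.1, -t.2.2.2.1, -t.2.2.2.2.1, -t.2.2.2.2.2)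

/-- `tsite` of a negation. [folklore] -/
theorem tsite_negT (t : T6) : tsite (negT t) = -tsite t := by
  ext i; fin_cases i <;> rfl

/-- The `ℓ¹` norm of a tuple. [folklore] -/
def l1T (t : T6) : ℕ := t.1.natAbs + t.2.1.natAbs + t.2.2.1.natAbs + t.2.2.2.1.natAbs + t.2.2.2.2.1.natAbs + t.2.2.2.2.2.natAbs

/-- `l1 (tsite t) = l1T t`. [folklore] -/
theorem l1_tsite (t : T6) : l1 (tsite t) = l1T t := by
  simp [l1, l1T, tsite, Fin.sum_univ_succ]
  ring

/-- **The tuple model of `mstep`.** [folklore] -/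
def mstepT (τ : ℕ) (S : List (T6 × ℕ)) (a : Fin 6 × Bool) : Option (List (T6 × ℕ)) :=
  if (S.any fun q => decide (q.1 = stepT a)) then none
  else some ((negT (stepT a), 1) ::
    (S.map fun q => (subT q.1 (stepT a), q.2 + 1)).filter fun q => decide (q.2 ≤ τ - 1 ∧ l1T q.1 ≤ τ - q.2))

/-- **`mstepT` models `mstep`.** [folklore] -/
theorem mstep_ofListState (τ : ℕ) (S : List (T6 × ℕ)) (a : Fin 6 × Bool) :
    mstep τ (ofListState S) a = (mstepT τ S a).map ofListState := by
  have hex : (∃ q ∈ ofListState S, q.1 = stepVec a) ↔ (S.any fun q => decide (q.1 = stepT a)) = true := by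
    simp only [ofListState, List.mem_toFinset, List.mem_map, List.any_eq_true, decide_eq_true_eq]
    constructor
    · rintro ⟨q, ⟨p, hp, rfl⟩, hq⟩
      exact ⟨p, hp, tsite_injective (by rw [tsite_stepT]; exact hq)⟩
    · rintro ⟨p, hp, hq⟩
      exact ⟨(tsite p.1, p.2), ⟨p, hp, rfl⟩, by simp [hq, tsite_stepT]⟩
  unfold mstep mstepT
  by_cases h : (S.any fun q => decide (q.1 = stepT a)) = true
  · rw [if_pos (hex.2 h), if_pos h]; rfl
  · rw [if_neg (mt hex.1 h), if_neg h, Option.map_some]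
    congr 1
    ext q
    simp only [ofListState, Finset.mem_insert, Finset.mem_filter, Finset.mem_image, List.mem_toFinset, List.mem_map,
      List.mem_cons, List.mem_filter, decide_eq_true_eq]
    constructor
    · rintro (rfl | ⟨⟨q', ⟨p, hp, rfl⟩, rfl⟩, hage, hl1⟩)
      · exact ⟨(negT (stepT a), 1), Or.inl rfl, by simp [tsite_negT, tsite_stepT]⟩
      · refine ⟨(subT p.1 (stepT a), p.2 + 1), Or.inr ⟨⟨p, hp, rfl⟩, hage, ?_⟩, ?_⟩
        · rw [← l1_tsite, tsite_subT, tsite_stepT]; exact hl1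
        · simp [tsite_subT, tsite_stepT]
    · rintro ⟨p', (rfl | ⟨⟨p, hp, rfl⟩, hage, hl1⟩), rfl⟩
      · left; simp [tsite_negT, tsite_stepT]
      · right
        refine ⟨⟨(tsite p.1, p.2), ⟨p, hp, rfl⟩, by simp [tsite_subT, tsite_stepT]⟩, hage, ?_⟩
        show l1 (tsite (subT p.1 (stepT a))) ≤ τ - (p.2 + 1)
        rw [l1_tsite]; exact hl1

/-- Lists that are permutations of each other give the same state. [folklore] -/
theorem ofListState_eq_of_isPerm {X Y : List (T6 × ℕ)} (h : X.isPerm Y = true) : ofListState X = ofListState Y :=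
  List.toFinset_eq_of_perm _ _ ((List.isPerm_iff.1 h).map _)

/-! #### Permutations of `Fin 6` from their lexicographic index (Lehmer code) -/

/-- Lehmer decoding: the `k`-th permutation (lexicographic) of the list `l`, first `n` places. [folklore] -/
def lehmerAux : ℕ → ℕ → List ℕ → List ℕ
  | 0, _, _ => []
  | n + 1, k, l => l.getD (k / n.factorial) 0 :: lehmerAux n (k % n.factorial) (l.eraseIdx (k / n.factorial))

/-- Image of `i` under the permutation of `{0,…,5}` with lexicographic index `k`. [folklore] -/
def fpermVal (k i : ℕ) : ℕ := (lehmerAux 6 k [0, 1, 2, 3, 4, 5]).getD i 0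

/-- Consistency of a permutation table `P` (as products of transpositions) with the Lehmer decoding. Decidable. [folklore] -/
def PermsOK (P : List (Equiv.Perm (Fin 6))) : Prop := ∀ k < 720, ∀ i : Fin 6, ((P.getD k (Equiv.refl _)) i : ℕ) = fpermVal k i

/-- The fast signed-permutation action on tuples, symmetry number `c`. [folklore] -/
def fsmul (c : ℕ) (t : T6) : T6 :=
  let k := c % 720
  let s := c / 720
  let f : ℕ → ℤ := fun i => if Nat.testBit s i then -tget t (fpermVal k i) else tget t (fpermVal k i)
  (f 0, f 1, f 2, f 3, f 4, f 5)

/-- **`fsmul` models `smulSite` of `spermOf6`** (given the consistency of the table). [folklore] -/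
theorem tsite_fsmul {P : List (Equiv.Perm (Fin 6))} (hP : PermsOK P) (c : ℕ) (t : T6) :
    tsite (fsmul c t) = smulSite (spermOf6 P c) (tsite t) := by
  have hk : c % 720 < 720 := Nat.mod_lt _ (by norm_num)
  have hv : ∀ i : Fin 6, tget t (fpermVal (c % 720) i) = tsite t ((P.getD (c % 720) (Equiv.refl _)) i) := fun i => by
    rw [← hP _ hk i, tget_fin]
  ext i
  have h1 : tsite (fsmul c t) i =
      if Nat.testBit (c / 720) i then -tget t (fpermVal (c % 720) i) else tget t (fpermVal (c % 720) i) := by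
    fin_cases i <;> rfl
  rw [h1, hv i]
  simp only [smulSite, spermOf6]
  cases Nat.testBit (c / 720) i <;> simp

/-- `smulState` in the tuple model. [folklore] -/
theorem smulState_ofListState {P : List (Equiv.Perm (Fin 6))} (hP : PermsOK P) (c : ℕ) (S : List (T6 × ℕ)) :
    smulState (spermOf6 P c) (ofListState S) = ofListState (S.map fun q => (fsmul c q.1, q.2)) := by
  ext q
  simp only [smulState, ofListState, Finset.mem_image, List.mem_toFinset, List.mem_map]
  constructor
  · rintro ⟨q', ⟨p, hp, rfl⟩, rfl⟩
    exact ⟨(fsmul c p.1, p.2), ⟨p, hp, rfl⟩, by simp [tsite_fsmul hP]⟩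
  · rintro ⟨p', ⟨p, hp, rfl⟩, rfl⟩
    exact ⟨(tsite p.1, p.2), ⟨p, hp, rfl⟩, by simp [tsite_fsmul hP]⟩

/-! #### The fast structural row check -/

variable (P : List (Equiv.Perm (Fin 6))) (T : List (List (List ℕ × List ℕ)))

/-- Decoded tuple list of row `i`. [folklore] -/
def stT (i : ℕ) : List (T6 × ℕ) :=
  match cget T i with
  | some r => r.1.map decPT
  | none => []

/-- `ofListState (stT T i) = sstC T i`. [folklore] -/
theorem ofListState_stT (i : ℕ) : ofListState (stT T i) = sstC T i := by
  unfold stT sstC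
  cases cget T i with
  | none => simp [ofListState]
  | some r => rfl

/-- Raw successor code of row `i` at letter number `l`. [folklore] -/
def ssuccRaw (i l : ℕ) : Option ℕ :=
  match cget T i with
  | some r => r.2.find? fun m => m % 12 = l
  | none => none

/-- Letter numbers: `encLetter a = 2·axis + [negative]`. [folklore] -/
def encLetter (a : Fin 6 × Bool) : ℕ := 2 * (a.1 : ℕ) + if a.2 then 0 else 1

/-- `decLetter6` inverts `encLetter`, and letter numbers are `< 12`. [folklore] -/
theorem decLetter6_encLetter : ∀ a : Fin 6 × Bool, decLetter6 (encLetter a) = a ∧ encLetter a < 12 := by decide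

/-- `decLetter6` is injective on `[0, 12)` (in the form needed). [folklore] -/
theorem decLetter6_inj : ∀ u < 12, ∀ v < 12, decLetter6 u = decLetter6 v → u = v := by decide

/-- `ssuccC` through the raw code. [folklore] -/
theorem ssuccC_eq_raw (i : ℕ) {l : ℕ} (hl : l < 12) :
    ssuccC P T i (decLetter6 l) = (ssuccRaw T i l).map fun m => (m / 12 % 8192, spermOf6 P (m / 98304)) := by
  unfold ssuccC ssuccRaw
  cases cget T i with
  | none => rfl
  | some r =>
    simp only [List.find?_map, Option.map_map]
    have hpred : ((fun q : (Fin 6 × Bool) × ℕ × SPerm 6 => decide (q.1 = decLetter6 l)) ∘ decSucc6 P) =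
        fun m => decide (m % 12 = l) := by
      funext m
      simp only [Function.comp, decSucc6]
      by_cases h : m % 12 = l
      · simp [h]
      · have : decLetter6 (m % 12) ≠ decLetter6 l := fun h' => h (decLetter6_inj _ (Nat.mod_lt _ (by norm_num)) _ hl h')
        simp [h, this]
    rw [hpred]
    rfl

/-- **The fast structural check of row `i`** (tuple arithmetic only). [folklore] -/
def URowOKF (τ N i : ℕ) : Bool :=
  (List.range 12).all fun l =>
    match ssuccRaw T i l, mstepT τ (stT T i) (decLetter6 l) with
    | none, none => true
    | some m, some X =>
      decide (m / 12 % 8192 < N) && X.isPerm ((stT T (m / 12 % 8192)).map fun q => (fsmul (m / 98304) q.1, q.2))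
    | _, _ => false

/-- **Soundness of the fast row check.** [folklore] -/
theorem urowOKC_of_fast {P : List (Equiv.Perm (Fin 6))} (hP : PermsOK P) {τ N i : ℕ} (h : URowOKF T τ N i = true) :
    URowOKC P T τ N i := by
  intro a
  obtain ⟨ha, hl⟩ := decLetter6_encLetter a
  have hrow := List.all_eq_true.1 h (encLetter a) (List.mem_range.2 hl)
  rw [← ha, ssuccC_eq_raw P T i hl, ← ofListState_stT T i, mstep_ofListState]
  generalize hm : ssuccRaw T i (encLetter a) = om at hrow
  generalize hX : mstepT τ (stT T i) (decLetter6 (encLetter a)) = oX at hrow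
  cases om with
  | none =>
    cases oX with
    | none => exact ⟨rfl, fun p hp => by simp at hp⟩
    | some X => simp at hrow
  | some m =>
    cases oX with
    | none => simp at hrow
    | some X =>
      simp only [Bool.and_eq_true, decide_eq_true_eq] at hrow
      obtain ⟨hN, hperm⟩ := hrow
      refine ⟨?_, fun p hp => ?_⟩
      · simp only [Option.map_some]
        rw [ofListState_eq_of_isPerm hperm, ← ofListState_stT T, smulState_ofListState hP]
      · simp only [Option.map_some, Option.mem_def, Option.some.injEq] at hp
        subst hp; exact hN

/-- The fast check of the rows `lo, …, lo + cnt − 1`. [folklore] -/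
def URowsOKF (τ N lo cnt : ℕ) : Bool := (List.range' lo cnt).all fun i => URowOKF T τ N i

/-- **Soundness of a range of fast checks.** [folklore] -/
theorem urowsOKC_of_fast {P : List (Equiv.Perm (Fin 6))} (hP : PermsOK P) {τ N lo cnt : ℕ}
    (h : URowsOKF T τ N lo cnt = true) : URowsOKC P T τ N lo (lo + cnt) := by
  intro i hi hlo
  exact urowOKC_of_fast T hP (List.all_eq_true.1 h i (List.mem_range'_1.2 ⟨hlo, hi⟩))

/-- Support check as a `Bool` over a row range: coordinate `5` of every encoded site is `0`. [folklore] -/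
def USuppRowsF (lo cnt : ℕ) : Bool :=
  (List.range' lo cnt).all fun i => (stT T i).all fun q => decide (q.1.2.2.2.2.2 = 0)

/-- **Soundness of the fast support check.** [folklore] -/
theorem usuppRowsC_of_fast {lo cnt : ℕ} (h : USuppRowsF T lo cnt = true) : USuppRowsC T lo (lo + cnt) := by
  intro i hi hlo q hq
  have hrow := List.all_eq_true.1 h i (List.mem_range'_1.2 ⟨hlo, hi⟩)
  rw [← ofListState_stT T i] at hq
  simp only [ofListState, List.mem_toFinset, List.mem_map] at hq
  obtain ⟨p, hp, rfl⟩ := hq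
  have := List.all_eq_true.1 hrow p hp
  simp only [decide_eq_true_eq] at this
  show tsite p.1 (Fin.last 5) = 0
  simpa [tsite] using this

end Fast

end Summit.CriticalPhenomena.PercolationContinuityZ3.Theorems.Pcint
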